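import Summits.BirchSwinnertonDyer.BirchSwinnertonDyer.Theorems.ManinLocalTwoThreeCubeRootDescentClosed
import Summits.BirchSwinnertonDyer.BirchSwinnertonDyer.Theorems.ManinLocalTwoThreeKummerSquareNotSquare
import Summits.BirchSwinnertonDyer.Rank1Residual.ManinAdditive.KatoShiftTwoCoreLaws
import HarnessLib

/-!
# Square-root descent in the `Γ₀`-tower at `ℓ = 2`: C2 v21 stub 6b‴ reduced to its odd-Nebentypus half
(route `ManinLocalTwoThree`, crux C2 `ManinOddAtFour` stmt-BirchSwinnertonDyer-22967; cell bsd-f2-manin, p2 gen 17; `--supports …-22967`)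

The `p = 2` twin of the cube-root descent T-an-39 A/B/F (`CuspidalKummerCubeDescent`, `…Theorems.ManinLocalTwoThreeCubeRootDescent{,Closed}`:
N1/N2, `newmanCond_descentExp`, LAW₃ ⟸ P79), run on cuspidal Kummer SQUARE representatives `Ξ·B²·qⁿ¹ = qⁿ²·g·A²`
(`CuspidalKummer.IsCuspidalKummerRep`) with the geometric leaf replaced by p2 g16's UNCONDITIONAL `SigmaSquareRoot.kummerSeries_not_sq_of_level_mul`
(`Ξ_T` of a rational `2`-torsion point on an `X₀(N)`-optimal datum is not a square in `K_{mN}`, `m ∣ N`).  PROVED (no `sorry`, no def, nothing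
conjectured): N1₂ `fortyEight_dvd_sum_of_isCuspidalKummerRep` (`n₂ − n₁ = S₁(r)/24` by the tree theorems M1/M2, `2 ∣ n₂ − n₁` by `q`-orders,
hence **`48 ∣ S₁(r)`**); D₂ `newmanCond_two_mul_of_half` (all `r_δ` even, `r = 2s` on `N.divisors`, `s = 0` elsewhere, `48 ∣ S₁(r)` AND
`∏ δ^{|s_δ|}` a square ⟹ `NewmanCond (2N) s 0` — `Σ (2N/δ) s_δ = Σ (N/δ) r_δ`; the square condition is the ONE datum not inherited at `ℓ = 2`,
automatic at `ℓ = 3` by `isSquare_of_isSquare_pow_three`); N2₂ `not_isCuspidalKummerRep_of_newmanCond_half` (`u := η_s·(A/B) ∈ K_{2N}` by M1 at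
`2N` + M0, `u² = Ξ_T` by `etaLaurent_half_sq` — against `kummerSeries_not_sq_of_level_mul` at `m = 2`); the **DICHOTOMY
`exists_odd_or_not_isSquare_of_isCuspidalKummerRep`** (unconditional, blindness-free, `c`-free: every cuspidal Kummer representative of `Ξ_T` —
lattice-optimal datum, `2 ∣ N`, any rational `2`-torsion abscissa — has an ODD `r_δ`, `δ ∣ N`, OR a NON-SQUARE `∏_{δ∣N} δ^{|r_δ/2|}`, i.e. `η_{r/2}`
carries a non-trivial quadratic Nebentypus `(∏ δ^{r_δ/2} | d)` on `Γ₀(2N)`); `exists_odd_of_isSquare_half`; `exists_not_four_dvd_of_isCuspidalKummerRep`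
(some `r_δ ≢ 0 (mod 4)`); EDGES BY NAME `cuspidalKummerOddExponentOnCore_of_isSquare_half` (6b‴ `CuspidalKummer.CuspidalKummerOddExponentOnCore` ⟸
its odd-Nebentypus residual, stated inline as the hypothesis; equivalent to 6b‴ by the dichotomy) and `cuspidalKummerOddExponent_of_isSquare_half`
(an's E-an-53 at `4 ∣ N`, likewise).

HONEST FRAMING.  Closed: the half of 6b‴ / E-an-53 in which the descended `η`-quotient has TRIVIAL character (`√Ξ_T ∈ K_{2N}`, impossible by
optimality + square-root monodromy).  OPEN: the half in which `η_{r/2}` has a non-trivial quadratic character `χ_P` (`P = ∏ δ^{r_δ/2}` non-square,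
`rad P ∣ N`): then `√Ξ_T = η_{r/2}·(A/B)` lives on the index-`2` cover of `X₀(2N)` cut out by `ker χ_P`, i.e. `π^*ι(T) ∈ J₀(2N)[2]` is the
Shimura-type class of `χ_P` (MEMO-an §78/§79.6; an's E-an-152/154/155 territory — such `T` should be Kummer-BLIND); C2-hard on its locus, NOT
claimed.  BSD is not proved by this; Manin's conjecture is not proved; C2 `ManinOddAtFour` and C3 remain OPEN.
[folklore]
-/

set_option autoImplicit false
-- lint-debt: the directory name repeats the summit name (sibling precedent `ManinLocalTwoThreeCubeRootDescent.lean`)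
set_option linter.dupNamespace false

noncomputable section

open scoped NumberField
open PowerSeries CongruenceSubgroup
open IsDedekindDomain IsDedekindDomain.HeightOneSpectrum Rat.HeightOneSpectrum
open WeierstrassCurve Literature.NumberTheory.EllipticCurves Literature.NumberTheory.EllipticCurves.ModularForms
open Summit.BirchSwinnertonDyer.Rank1Residual.ManinAdditive.CuspidalKummer
open Summit.BirchSwinnertonDyer.Rank1Residual.ManinAdditive.CuspidalKummerThree
open Summit.BirchSwinnertonDyer.BirchSwinnertonDyer.Theorems.ManinLocalTwoThree.CubeRootDescent
open Summit.BirchSwinnertonDyer.BirchSwinnertonDyer.Theorems.ManinLocalTwoThree.SigmaSquareRoot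

namespace Summit.BirchSwinnertonDyer.BirchSwinnertonDyer.Theorems.ManinLocalTwoThree.SquareRootDescent

/-! ### §1 The first descent N1₂: `n₂ − n₁ = S₁(r)/24` and `48 ∣ S₁(r)` -/

/-- The Laurent form of a cuspidal Kummer SQUARE representative: `Ξ = q^{n₂−n₁}·g·(A/B)²` in `ℂ((q))`. [folklore] -/
theorem laurent_sq_eq_of_rep {Ξ : ℚ⟦X⟧} {g A B : ℤ⟦X⟧} (hB : B ≠ 0) {n₁ n₂ : ℕ}
    (hEq : Ξ * (B.map (Int.castRingHom ℚ)) ^ 2 * X ^ n₁ = (X ^ n₂ * g * A ^ 2).map (Int.castRingHom ℚ)) :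
    HahnSeries.ofPowerSeries ℤ ℂ (Ξ.map (algebraMap ℚ ℂ)) =
      HahnSeries.single ((n₂ : ℤ) - n₁) (1 : ℂ) * toLaurent g * (toLaurent A / toLaurent B) ^ 2 := by
  have h := congrArg (fun p => HahnSeries.ofPowerSeries ℤ ℂ (PowerSeries.map (algebraMap ℚ ℂ) p)) hEq
  simp only [map_mul, map_pow, PowerSeries.map_X, map_algebraMap_map_intCast, HahnSeries.ofPowerSeries_X,
    HahnSeries.single_pow, one_pow, nsmul_eq_mul, mul_one] at h
  set ΞL := HahnSeries.ofPowerSeries ℤ ℂ (PowerSeries.map (algebraMap ℚ ℂ) Ξ) with hΞL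
  have h' : ΞL * toLaurent B ^ 2 * HahnSeries.single (n₁ : ℤ) (1 : ℂ) =
      HahnSeries.single (n₂ : ℤ) (1 : ℂ) * toLaurent g * toLaurent A ^ 2 := h
  have hBL : toLaurent B ≠ 0 := toLaurent_ne_zero hB
  have hq₁ : (HahnSeries.single (n₁ : ℤ) (1 : ℂ) : LaurentSeries ℂ) ≠ 0 := single_ne_zero' _
  have hne : toLaurent B ^ 2 * HahnSeries.single (n₁ : ℤ) (1 : ℂ) ≠ 0 := mul_ne_zero (pow_ne_zero 2 hBL) hq₁
  have hsplit : (HahnSeries.single ((n₂ : ℤ) - n₁) (1 : ℂ) : LaurentSeries ℂ) * HahnSeries.single (n₁ : ℤ) 1 =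
      HahnSeries.single (n₂ : ℤ) 1 := by
    rw [single_mul_single']; congr 1; ring
  have hAB : (toLaurent A / toLaurent B) ^ 2 * toLaurent B ^ 2 = toLaurent A ^ 2 := by
    rw [div_pow, div_mul_cancel₀ _ (pow_ne_zero 2 hBL)]
  symm
  calc HahnSeries.single ((n₂ : ℤ) - n₁) (1 : ℂ) * toLaurent g * (toLaurent A / toLaurent B) ^ 2
      = HahnSeries.single ((n₂ : ℤ) - n₁) (1 : ℂ) * toLaurent g * (toLaurent A / toLaurent B) ^ 2 *
          (toLaurent B ^ 2 * HahnSeries.single (n₁ : ℤ) (1 : ℂ)) *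
          (toLaurent B ^ 2 * HahnSeries.single (n₁ : ℤ) (1 : ℂ))⁻¹ := by rw [mul_inv_cancel_right₀ hne]
    _ = HahnSeries.single ((n₂ : ℤ) - n₁) (1 : ℂ) * HahnSeries.single (n₁ : ℤ) 1 * toLaurent g *
          ((toLaurent A / toLaurent B) ^ 2 * toLaurent B ^ 2) *
          (toLaurent B ^ 2 * HahnSeries.single (n₁ : ℤ) (1 : ℂ))⁻¹ := by ring
    _ = HahnSeries.single (n₂ : ℤ) (1 : ℂ) * toLaurent g * toLaurent A ^ 2 *
          (toLaurent B ^ 2 * HahnSeries.single (n₁ : ℤ) (1 : ℂ))⁻¹ := by rw [hsplit, hAB]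
    _ = ΞL * toLaurent B ^ 2 * HahnSeries.single (n₁ : ℤ) (1 : ℂ) *
          (toLaurent B ^ 2 * HahnSeries.single (n₁ : ℤ) (1 : ℂ))⁻¹ := by rw [h']
    _ = ΞL := by rw [mul_assoc ΞL, mul_inv_cancel_right₀ hne]

/-- `q`-orders in `ℚ⟦q⟧`: `2 ∣ n₂ − n₁` for a square representative of a series with `Ξ(0) ≠ 0` (`g(0) = 1`). [folklore] -/
theorem two_dvd_sub_of_rep {Ξ : ℚ⟦X⟧} (hΞ0 : constantCoeff Ξ ≠ 0) {g A B : ℤ⟦X⟧}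
    (hg0 : constantCoeff g = 1) (hB : B ≠ 0) {n₁ n₂ : ℕ}
    (hEq : Ξ * (B.map (Int.castRingHom ℚ)) ^ 2 * X ^ n₁ = (X ^ n₂ * g * A ^ 2).map (Int.castRingHom ℚ)) :
    (2 : ℤ) ∣ (n₂ : ℤ) - n₁ := by
  have hinj : Function.Injective (PowerSeries.map (Int.castRingHom ℚ)) :=
    PowerSeries.map_injective _ (RingHom.injective_int _)
  have hB' : PowerSeries.map (Int.castRingHom ℚ) B ≠ 0 := fun h => hB (hinj (by rw [h, map_zero]))
  have hΞu : IsUnit Ξ := isUnit_iff_constantCoeff.mpr (isUnit_iff_ne_zero.mpr hΞ0)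
  have hgu : IsUnit (PowerSeries.map (Int.castRingHom ℚ) g) := by
    rw [isUnit_iff_constantCoeff, ← coeff_zero_eq_constantCoeff, coeff_map, coeff_zero_eq_constantCoeff, hg0,
      map_one]
    exact isUnit_one
  rw [map_mul, map_mul, map_pow, map_pow, PowerSeries.map_X] at hEq
  have hA' : PowerSeries.map (Int.castRingHom ℚ) A ≠ 0 := by
    intro h
    rw [h, zero_pow two_ne_zero, mul_zero] at hEq
    exact (mul_ne_zero (mul_ne_zero hΞu.ne_zero (pow_ne_zero 2 hB')) (pow_ne_zero _ X_ne_zero)) hEq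
  have hord := congrArg PowerSeries.order hEq
  rw [order_mul, order_mul, order_zero_of_unit hΞu, zero_add, order_pow, order_X_pow, order_mul, order_mul,
    order_X_pow, order_zero_of_unit hgu, add_zero, order_pow, ← coe_toNat_order hB', ← coe_toNat_order hA'] at hord
  set kB := (PowerSeries.map (Int.castRingHom ℚ) B).order.toNat
  set kA := (PowerSeries.map (Int.castRingHom ℚ) A).order.toNat
  have hnat : 2 * kB + n₁ = n₂ + 2 * kA := by
    have : ((2 * kB + n₁ : ℕ) : ℕ∞) = ((n₂ + 2 * kA : ℕ) : ℕ∞) := by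
      push_cast
      simpa [smul_eq_mul] using hord
    exact_mod_cast this
  omega

/-- **N1₂ (PROVED, the exponent identity): `n₂ − n₁ = S₁(r)/24`** for every cuspidal Kummer representative — `G₀ = qⁿ²g/qⁿ¹ ∈ K_N`
and `η_r = q^{S₁/24}·g ∈ K_N` (M1) give `q^{n₂−n₁−S₁/24} ∈ K_N`, so the exponent vanishes (M2). [folklore] -/
theorem sub_eq_sum_div_of_isCuspidalKummerRep {N : ℕ} [NeZero N] {Ξ : ℚ⟦X⟧} {r : ℕ → ℤ} {g A B : ℤ⟦X⟧}
    (hrep : IsCuspidalKummerRep N Ξ r g A B) :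
    ∃ n₁ n₂ : ℕ, (n₂ : ℤ) - n₁ = (∑ δ ∈ N.divisors, (δ : ℤ) * r δ) / 24 ∧
      Ξ * (B.map (Int.castRingHom ℚ)) ^ 2 * X ^ n₁ = (X ^ n₂ * g * A ^ 2).map (Int.castRingHom ℚ) := by
  obtain ⟨hNew, hEta, -, -, n₁, n₂, hG, hEq⟩ := hrep
  exact ⟨n₁, n₂, sub_eq_sum_div_of_rep etaQuotientMemFunctionField monomialNotModularFunction hNew hEta hG, hEq⟩

/-- **N1₂ (PROVED): `48 ∣ S₁(r) = Σ δ r_δ`** for every cuspidal Kummer (square) representative of a series with `Ξ(0) ≠ 0`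
(`n₂ − n₁ = S₁/24` by M1/M2 and `2 ∣ n₂ − n₁` by `q`-orders; Newman gives `24 ∣ S₁`).  The `p = 2` twin of N1
`cubeRepFirstDescent` (`72 ∣ S₁`). [folklore] -/
theorem fortyEight_dvd_sum_of_isCuspidalKummerRep {N : ℕ} [NeZero N] {Ξ : ℚ⟦X⟧} (hΞ0 : constantCoeff Ξ ≠ 0)
    {r : ℕ → ℤ} {g A B : ℤ⟦X⟧} (hrep : IsCuspidalKummerRep N Ξ r g A B) :
    (48 : ℤ) ∣ ∑ δ ∈ N.divisors, (δ : ℤ) * r δ := by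
  obtain ⟨hNew, hEta, hB, -, n₁, n₂, hG, hEq⟩ := hrep
  have h1 := sub_eq_sum_div_of_rep etaQuotientMemFunctionField monomialNotModularFunction hNew hEta
    (n₁ := n₁) (n₂ := n₂) hG
  have h2 := two_dvd_sub_of_rep hΞ0 hEta.1 hB hEq
  have h24 := hNew.sum_mul_dvd
  omega

/-! ### §2 The descended exponent vector `s = r/2` (on `N.divisors`, zero elsewhere) at level `2N` -/

/-- The divisors of `N` are divisors of `2N`. [folklore] -/
theorem divisors_subset_divisors_two_mul {N : ℕ} (hN : N ≠ 0) : N.divisors ⊆ (2 * N).divisors :=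
  Nat.divisors_subset_of_dvd (by positivity) (Dvd.intro_left 2 rfl)

/-- Sums over `(2N).divisors` of a quantity vanishing with the exponent restrict to `N.divisors` when the exponent vector
vanishes off `N.divisors`. [folklore] -/
theorem sum_divisors_two_mul_of_zero_off {N : ℕ} (hN : N ≠ 0) (s : ℕ → ℤ) (hs0 : ∀ δ, δ ∉ N.divisors → s δ = 0)
    (F : ℕ → ℤ → ℤ) (hF : ∀ δ, F δ 0 = 0) :
    ∑ δ ∈ (2 * N).divisors, F δ (s δ) = ∑ δ ∈ N.divisors, F δ (s δ) :=
  (Finset.sum_subset (divisors_subset_divisors_two_mul hN) (fun δ _ hδ => by rw [hs0 δ hδ, hF])).symm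

/-- **D₂ (PROVED).  Newman's weight-`0` conditions descend along `r ↦ r/2` to level `2N`** as soon as every `r_δ` is even
(`r = 2s` on the divisors of `N`, `s = 0` elsewhere), `48 ∣ Σ δ r_δ`, AND `∏ δ^{|s_δ|}` is a square: the second congruence at
level `2N` is Newman's second congruence for `r` at level `N` on the nose (`Σ (2N/δ) s_δ = Σ (N/δ) r_δ`).  The square condition is
the one datum NOT inherited at `ℓ = 2` (contrast `newmanCond_descentExp` at `ℓ = 3`). [folklore] -/
theorem newmanCond_two_mul_of_half {N : ℕ} (hN : N ≠ 0) {r s : ℕ → ℤ} (hr : NewmanCond N r 0)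
    (hrs : ∀ δ ∈ N.divisors, r δ = 2 * s δ) (hs0 : ∀ δ, δ ∉ N.divisors → s δ = 0)
    (h48 : (48 : ℤ) ∣ ∑ δ ∈ N.divisors, (δ : ℤ) * r δ)
    (hsq : IsSquare (∏ δ ∈ N.divisors, δ ^ (s δ).natAbs)) :
    NewmanCond (2 * N) s 0 := by
  refine ⟨?_, ?_, ?_, ?_⟩
  · rw [sum_divisors_two_mul_of_zero_off hN s hs0 (fun _ x => x) (fun _ => rfl)]
    have h0 := hr.sum_eq
    have : ∑ δ ∈ N.divisors, r δ = 2 * ∑ δ ∈ N.divisors, s δ := by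
      rw [Finset.mul_sum]
      exact Finset.sum_congr rfl fun δ hδ => hrs δ hδ
    omega
  · rw [sum_divisors_two_mul_of_zero_off hN s hs0 (fun δ x => (δ : ℤ) * x) (fun _ => mul_zero _)]
    have : ∑ δ ∈ N.divisors, (δ : ℤ) * r δ = 2 * ∑ δ ∈ N.divisors, (δ : ℤ) * s δ := by
      rw [Finset.mul_sum]
      exact Finset.sum_congr rfl fun δ hδ => by rw [hrs δ hδ]; ring
    omega
  · rw [sum_divisors_two_mul_of_zero_off hN s hs0 (fun δ x => ((2 * N / δ : ℕ) : ℤ) * x) (fun _ => mul_zero _)]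
    have : ∑ δ ∈ N.divisors, ((2 * N / δ : ℕ) : ℤ) * s δ = ∑ δ ∈ N.divisors, ((N / δ : ℕ) : ℤ) * r δ := by
      refine Finset.sum_congr rfl fun δ hδ => ?_
      rw [Nat.mul_div_assoc 2 (Nat.dvd_of_mem_divisors hδ), Nat.cast_mul, Nat.cast_ofNat, hrs δ hδ]
      ring
    rw [this]
    exact hr.sum_div_dvd
  · have hprod : ∏ δ ∈ (2 * N).divisors, δ ^ (s δ).natAbs = ∏ δ ∈ N.divisors, δ ^ (s δ).natAbs :=
      (Finset.prod_subset (divisors_subset_divisors_two_mul hN)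
        (fun δ _ hδ => by rw [hs0 δ hδ]; simp)).symm
    rw [hprod]
    exact hsq

/-- `etaPos` of the half vector at level `2N`, squared, is `etaPos` of `r`. [folklore] -/
theorem etaPos_half_sq {N : ℕ} (hN : N ≠ 0) {r s : ℕ → ℤ} (hrs : ∀ δ ∈ N.divisors, r δ = 2 * s δ)
    (hs0 : ∀ δ, δ ∉ N.divisors → s δ = 0) : etaPos (2 * N) s ^ 2 = etaPos N r := by
  rw [etaPos, etaPos, ← Finset.prod_subset (divisors_subset_divisors_two_mul hN)
      (fun δ _ hδ => by rw [hs0 δ hδ]; simp), ← Finset.prod_pow]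
  refine Finset.prod_congr rfl fun δ hδ => ?_
  rw [← pow_mul, hrs δ hδ]
  congr 1
  omega

/-- `etaNeg` of the half vector at level `2N`, squared, is `etaNeg` of `r`. [folklore] -/
theorem etaNeg_half_sq {N : ℕ} (hN : N ≠ 0) {r s : ℕ → ℤ} (hrs : ∀ δ ∈ N.divisors, r δ = 2 * s δ)
    (hs0 : ∀ δ, δ ∉ N.divisors → s δ = 0) : etaNeg (2 * N) s ^ 2 = etaNeg N r := by
  rw [etaNeg, etaNeg, ← Finset.prod_subset (divisors_subset_divisors_two_mul hN)
      (fun δ _ hδ => by rw [hs0 δ hδ]; simp), ← Finset.prod_pow]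
  refine Finset.prod_congr rfl fun δ hδ => ?_
  rw [← pow_mul, hrs δ hδ]
  congr 1
  omega

/-- `2 · S₁(s at level 2N) = S₁(r)`. [folklore] -/
theorem two_mul_sum_half {N : ℕ} (hN : N ≠ 0) {r s : ℕ → ℤ} (hrs : ∀ δ ∈ N.divisors, r δ = 2 * s δ)
    (hs0 : ∀ δ, δ ∉ N.divisors → s δ = 0) :
    2 * ∑ δ ∈ (2 * N).divisors, (δ : ℤ) * s δ = ∑ δ ∈ N.divisors, (δ : ℤ) * r δ := by
  rw [sum_divisors_two_mul_of_zero_off hN s hs0 (fun δ x => (δ : ℤ) * x) (fun _ => mul_zero _), Finset.mul_sum]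
  refine Finset.sum_congr rfl fun δ hδ => ?_
  rw [hrs δ hδ]
  ring

/-- `η_s² = q^{S₁(r)/24}·g` in `ℂ((q))` for the half vector `s` at level `2N` under Newman's first congruence there. [folklore] -/
theorem etaLaurent_half_sq {N : ℕ} (hN : N ≠ 0) {r s : ℕ → ℤ} {g : ℤ⟦X⟧} (hEta : IsEtaUnitSeries N.divisors r g)
    (hrs : ∀ δ ∈ N.divisors, r δ = 2 * s δ) (hs0 : ∀ δ, δ ∉ N.divisors → s δ = 0)
    (hs : NewmanCond (2 * N) s 0) :
    etaLaurent (2 * N) s ^ 2 = HahnSeries.single ((∑ δ ∈ N.divisors, (δ : ℤ) * r δ) / 24) (1 : ℂ) * toLaurent g := by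
  have h24 := hs.sum_mul_dvd
  have h2S := two_mul_sum_half hN hrs hs0
  set S' := ∑ δ ∈ (2 * N).divisors, (δ : ℤ) * s δ
  have hexp : (2 : ℤ) * (S' / 24) = (∑ δ ∈ N.divisors, (δ : ℤ) * r δ) / 24 := by
    rw [← h2S]; omega
  rw [etaLaurent, mul_pow, single_pow', div_pow, ← toLaurent_pow, ← toLaurent_pow, etaPos_half_sq hN hrs hs0,
    etaNeg_half_sq hN hrs hs0, ← toLaurent_eq_div_of_isEtaUnitSeries hEta, Nat.cast_ofNat, hexp]

/-! ### §3 N2₂: no Newman square root — from `kummerSeries_not_sq_of_level_mul` at `m = 2` -/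

/-- `f(g(X))(0) = f(0)` when `g(0) = 0`. [folklore] -/
private theorem constantCoeff_subst_of_constantCoeff_eq_zero' {R : Type*} [CommRing R] {g : R⟦X⟧}
    (hg : constantCoeff g = 0) (f : R⟦X⟧) : constantCoeff (f.subst g) = constantCoeff f := by
  rw [← coeff_zero_eq_constantCoeff_apply, coeff_subst' (HasSubst.of_constantCoeff_zero' hg),
    finsum_eq_single _ 0]
  · simp
  · intro d hd
    rw [coeff_zero_eq_constantCoeff_apply, map_pow, hg, zero_pow hd, smul_zero]

/-- `Ξ_T(0) = 1` for a parametrisation germ (`z(0) = 0`, `(z²x)(0) = 1`). [folklore] -/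
theorem constantCoeff_kummerSeries (W : WeierstrassCurve ℚ) (c : ℤ) (e : ℚ) {a : ℕ → ℤ} {z : ℚ⟦X⟧}
    (hz : IsParamGerm W c a z) : constantCoeff (kummerSeries W c e z) = 1 := by
  have hz0 : constantCoeff z = 0 := hz.1
  rw [kummerSeries, map_sub, constantCoeff_subst_of_constantCoeff_eq_zero' hz0, constantCoeff_formalXMulSq,
    smul_eq_C_mul, map_mul, map_pow, hz0]
  simp

/-- **N2₂ (PROVED, unconditional): for a lattice-optimal `X₀(N)`-datum with `2 ∣ N`, THE germ `z` and a rational `2`-division root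
`x₀`, NO cuspidal Kummer representative of `Ξ_T` has `r = 2s` on `N.divisors` with `s` (zero elsewhere) satisfying Newman's conditions
at level `2N`** — `u := η_s·(A/B) ∈ K_{2N}` would be a square root of `Ξ_T`, against `kummerSeries_not_sq_of_level_mul` (`m = 2`).
The `p = 2` twin of N2 `noNewmanCubeRootRepAtThreeN_of_geometric`. [folklore] -/
theorem not_isCuspidalKummerRep_of_newmanCond_half
    (W : WeierstrassCurve ℚ) [W.IsElliptic] [W.IsGloballyMinimal] {N : ℕ} [NeZero N]
    (D : ModularParametrizationData W N) (a : ℕ → ℤ) (ha : ∀ n, (a n : ℂ) = cuspCoeff D.f n)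
    (h2 : 2 ∣ N) (hLat : ∀ z ∈ D.L.lattice, ∃ w ∈ periodLattice D.f, z = D.c * w)
    {x₀ : ℚ} (hx : W.twoTorsionPolynomial.toPoly.IsRoot x₀) (z : ℚ⟦X⟧) (hz : IsParamGerm W D.c a z)
    {r s : ℕ → ℤ} {g A B : ℤ⟦X⟧} (hrs : ∀ δ ∈ N.divisors, r δ = 2 * s δ)
    (hs0 : ∀ δ, δ ∉ N.divisors → s δ = 0) (hs : NewmanCond (2 * N) s 0) :
    ¬ IsCuspidalKummerRep N (kummerSeries W D.c x₀ z) r g A B := by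
  intro hrep
  obtain ⟨hNew, hEta, hB, hh, n₁, n₂, hG, hEq⟩ := hrep
  have hN : N ≠ 0 := NeZero.ne N
  haveI : NeZero (2 * N) := ⟨mul_ne_zero two_ne_zero hN⟩
  have he := sub_eq_sum_div_of_rep etaQuotientMemFunctionField monomialNotModularFunction hNew hEta
    (n₁ := n₁) (n₂ := n₂) hG
  have hΞ := laurent_sq_eq_of_rep hB hEq
  set u : LaurentSeries ℂ := etaLaurent (2 * N) s * (toLaurent A / toLaurent B) with hu
  have hu_mem : u ∈ modularFunctionField (2 * N) :=
    mul_mem (etaQuotientMemFunctionField (2 * N) s hs)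
      (modularFunctionFieldMono N (2 * N) (Dvd.intro_left 2 rfl) hh)
  have hsq : HahnSeries.ofPowerSeries ℤ ℂ ((kummerSeries W D.c x₀ z).map (algebraMap ℚ ℂ)) = u ^ 2 := by
    rw [hΞ, hu, mul_pow, etaLaurent_half_sq hN hEta hrs hs0 hs, ← he]
  exact kummerSeries_not_sq_of_level_mul W D a ha (m := 2) h2 hLat hx z hz u hu_mem hsq

/-! ### §4 The dichotomy and its corollaries -/

/-- **DICHOTOMY (PROVED, unconditional, blindness-free, `c`-free).**  Every cuspidal Kummer representative `(r, g, A, B)` of the Kummer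
square series `Ξ_T` of a rational `2`-torsion abscissa `x₀` on a lattice-optimal `X₀(N)`-datum, `2 ∣ N`, has an ODD `η`-exponent `r_δ`
(`δ ∣ N`) OR a NON-SQUARE half product `∏_{δ ∣ N} δ^{|r_δ/2|}` (the descended `η`-quotient `η_{r/2}` has a non-trivial quadratic
Nebentypus on `Γ₀(2N)`). [folklore] -/
theorem exists_odd_or_not_isSquare_of_isCuspidalKummerRep
    (W : WeierstrassCurve ℚ) [W.IsElliptic] [W.IsGloballyMinimal] {N : ℕ} [NeZero N]
    (D : ModularParametrizationData W N) (a : ℕ → ℤ) (ha : ∀ n, (a n : ℂ) = cuspCoeff D.f n)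
    (h2 : 2 ∣ N) (hLat : ∀ z ∈ D.L.lattice, ∃ w ∈ periodLattice D.f, z = D.c * w)
    {x₀ : ℚ} (hx : W.twoTorsionPolynomial.toPoly.IsRoot x₀) (z : ℚ⟦X⟧) (hz : IsParamGerm W D.c a z)
    {r : ℕ → ℤ} {g A B : ℤ⟦X⟧} (hrep : IsCuspidalKummerRep N (kummerSeries W D.c x₀ z) r g A B) :
    (∃ δ ∈ N.divisors, Odd (r δ)) ∨ ¬ IsSquare (∏ δ ∈ N.divisors, δ ^ (r δ / 2).natAbs) := by
  by_contra hcon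
  have hev : ∀ δ ∈ N.divisors, Even (r δ) := fun δ hδ =>
    Int.not_odd_iff_even.mp fun hodd => hcon (Or.inl ⟨δ, hδ, hodd⟩)
  have hsq : IsSquare (∏ δ ∈ N.divisors, δ ^ (r δ / 2).natAbs) := by
    by_contra h
    exact hcon (Or.inr h)
  have hN : N ≠ 0 := NeZero.ne N
  set s : ℕ → ℤ := fun δ => if δ ∈ N.divisors then r δ / 2 else 0 with hs_def
  have hrs : ∀ δ ∈ N.divisors, r δ = 2 * s δ := by
    intro δ hδ
    obtain ⟨k, hk⟩ := hev δ hδ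
    simp only [hs_def, if_pos hδ]
    omega
  have hs0 : ∀ δ, δ ∉ N.divisors → s δ = 0 := fun δ hδ => by simp only [hs_def, if_neg hδ]
  have hΞ0 : constantCoeff (kummerSeries W D.c x₀ z) ≠ 0 := by
    rw [constantCoeff_kummerSeries W D.c x₀ hz]; exact one_ne_zero
  have h48 := fortyEight_dvd_sum_of_isCuspidalKummerRep hΞ0 hrep
  have hsq' : IsSquare (∏ δ ∈ N.divisors, δ ^ (s δ).natAbs) := by
    have : ∏ δ ∈ N.divisors, δ ^ (s δ).natAbs = ∏ δ ∈ N.divisors, δ ^ (r δ / 2).natAbs :=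
      Finset.prod_congr rfl fun δ hδ => by simp only [hs_def, if_pos hδ]
    rw [this]
    exact hsq
  exact not_isCuspidalKummerRep_of_newmanCond_half W D a ha h2 hLat hx z hz hrs hs0
    (newmanCond_two_mul_of_half hN hrep.1 hrs hs0 h48 hsq') hrep

/-- **If the half product IS a square, some exponent is odd** (the trivial-Nebentypus half of E-an-53 / 6b‴, closed outright for EVERY rational
`2`-torsion point, blind or not). [folklore] -/
theorem exists_odd_of_isSquare_half
    (W : WeierstrassCurve ℚ) [W.IsElliptic] [W.IsGloballyMinimal] {N : ℕ} [NeZero N]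
    (D : ModularParametrizationData W N) (a : ℕ → ℤ) (ha : ∀ n, (a n : ℂ) = cuspCoeff D.f n)
    (h2 : 2 ∣ N) (hLat : ∀ z ∈ D.L.lattice, ∃ w ∈ periodLattice D.f, z = D.c * w)
    {x₀ : ℚ} (hx : W.twoTorsionPolynomial.toPoly.IsRoot x₀) (z : ℚ⟦X⟧) (hz : IsParamGerm W D.c a z)
    {r : ℕ → ℤ} {g A B : ℤ⟦X⟧} (hrep : IsCuspidalKummerRep N (kummerSeries W D.c x₀ z) r g A B)
    (hsq : IsSquare (∏ δ ∈ N.divisors, δ ^ (r δ / 2).natAbs)) :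
    ∃ δ ∈ N.divisors, Odd (r δ) :=
  (exists_odd_or_not_isSquare_of_isCuspidalKummerRep W D a ha h2 hLat hx z hz hrep).resolve_right
    (not_not_intro hsq)

/-- **COROLLARY (PROVED, unconditional): some `η`-exponent is `≢ 0 (mod 4)`** — if every `r_δ ≡ 0 (mod 4)` then all are even and
`∏ δ^{|r_δ/2|} = (∏ δ^{|r_δ/4|})²` is a square. [folklore] -/
theorem exists_not_four_dvd_of_isCuspidalKummerRep
    (W : WeierstrassCurve ℚ) [W.IsElliptic] [W.IsGloballyMinimal] {N : ℕ} [NeZero N]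
    (D : ModularParametrizationData W N) (a : ℕ → ℤ) (ha : ∀ n, (a n : ℂ) = cuspCoeff D.f n)
    (h2 : 2 ∣ N) (hLat : ∀ z ∈ D.L.lattice, ∃ w ∈ periodLattice D.f, z = D.c * w)
    {x₀ : ℚ} (hx : W.twoTorsionPolynomial.toPoly.IsRoot x₀) (z : ℚ⟦X⟧) (hz : IsParamGerm W D.c a z)
    {r : ℕ → ℤ} {g A B : ℤ⟦X⟧} (hrep : IsCuspidalKummerRep N (kummerSeries W D.c x₀ z) r g A B) :
    ∃ δ ∈ N.divisors, ¬ (4 : ℤ) ∣ r δ := by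
  by_contra hcon
  have h4 : ∀ δ ∈ N.divisors, (4 : ℤ) ∣ r δ := fun δ hδ => by
    by_contra h
    exact hcon ⟨δ, hδ, h⟩
  rcases exists_odd_or_not_isSquare_of_isCuspidalKummerRep W D a ha h2 hLat hx z hz hrep with
    ⟨δ, hδ, hodd⟩ | hnsq
  · obtain ⟨k, hk⟩ := h4 δ hδ
    exact (Int.not_even_iff_odd.mpr hodd) ⟨2 * k, by omega⟩
  · apply hnsq
    refine ⟨∏ δ ∈ N.divisors, δ ^ (r δ / 4).natAbs, ?_⟩
    rw [← sq, ← Finset.prod_pow]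
    refine Finset.prod_congr rfl fun δ hδ => ?_
    rw [← pow_mul]
    congr 1
    obtain ⟨k, hk⟩ := h4 δ hδ
    omega

/-! ### §5 Edges BY NAME: stub 6b‴ and E-an-53 reduced to their odd-Nebentypus residuals -/

/-- **C2 v21 stub 6b‴ `CuspidalKummer.CuspidalKummerOddExponentOnCore` ⟸ its ODD-NEBENTYPUS RESIDUAL** (stated inline as the hypothesis
`hL`: on the core at `16 ∣ N`, for a non-blind rational `2`-torsion point, every cuspidal Kummer representative with all exponents even has
`∏ δ^{|r_δ/2|}` a square).  By the dichotomy this residual is equivalent to 6b‴ itself; the trivial-character half is discharged. [folklore] -/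
theorem cuspidalKummerOddExponentOnCore_of_isSquare_half
    (hL : ∀ (W : WeierstrassCurve ℚ) [W.IsElliptic] [W.IsGloballyMinimal] {N : ℕ} [NeZero N]
      (D : ModularParametrizationData W N) (a : ℕ → ℤ), (∀ n, (a n : ℂ) = cuspCoeff D.f n) →
      2 ^ 4 ∣ N → (∀ z ∈ D.L.lattice, ∃ w ∈ periodLattice D.f, z = D.c * w) →
      ((primesEquiv (R := 𝓞 ℚ)).symm ⟨2, Nat.prime_two⟩).valuation ℚ W.j < 1 →
      (∀ d : ℤ, d = -1 ∨ d = 2 ∨ d = -2 →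
        2 ≤ (W.quadraticTwist (d : ℚ)).conductorExponent ((primesEquiv (R := ℤ)).symm ⟨2, Nat.prime_two⟩)) →
      ∀ (a₂ a₄ e : ℤ), W.a₁ = 0 → W.a₃ = 0 → W.a₂ = a₂ → W.a₄ = a₄ →
      W.twoTorsionPolynomial.toPoly.IsRoot (e : ℚ) → ¬ KummerBlindAtTwo a₂ a₄ e →
      ∀ z : ℚ⟦X⟧, IsParamGerm W D.c a z →
      ∀ (r : ℕ → ℤ) (g A B : ℤ⟦X⟧), IsCuspidalKummerRep N (kummerSeries W D.c ((e : ℚ)) z) r g A B →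
      (∀ δ ∈ N.divisors, Even (r δ)) → IsSquare (∏ δ ∈ N.divisors, δ ^ (r δ / 2).natAbs)) :
    CuspidalKummerOddExponentOnCore := by
  intro W _ _ N _ D a ha h16 hLat hj hcore a₂ a₄ e ha1 ha3 ha2 ha4 he hnb z hz r g A B hrep
  have h2 : 2 ∣ N := (by norm_num : (2 : ℕ) ∣ 2 ^ 4).trans h16
  rcases exists_odd_or_not_isSquare_of_isCuspidalKummerRep W D a ha h2 hLat he z hz hrep with h | hnsq
  · exact h
  · by_contra hcon
    have hev : ∀ δ ∈ N.divisors, Even (r δ) := fun δ hδ =>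
      Int.not_odd_iff_even.mp fun hodd => hcon ⟨δ, hδ, hodd⟩
    exact hnsq (hL W D a ha h16 hLat hj hcore a₂ a₄ e ha1 ha3 ha2 ha4 he hnb z hz r g A B hrep hev)

/-- **an's E-an-53 `CuspidalKummer.CuspidalKummerOddExponent` (at `4 ∣ N`) ⟸ its odd-Nebentypus residual**, likewise. [folklore] -/
theorem cuspidalKummerOddExponent_of_isSquare_half
    (hL : ∀ (W : WeierstrassCurve ℚ) [W.IsElliptic] [W.IsGloballyMinimal] {N : ℕ} [NeZero N]
      (D : ModularParametrizationData W N) (a : ℕ → ℤ), (∀ n, (a n : ℂ) = cuspCoeff D.f n) →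
      4 ∣ N → (∀ z ∈ D.L.lattice, ∃ w ∈ periodLattice D.f, z = D.c * w) →
      ∀ (a₂ a₄ e : ℤ), W.a₁ = 0 → W.a₃ = 0 → W.a₂ = a₂ → W.a₄ = a₄ →
      W.twoTorsionPolynomial.toPoly.IsRoot (e : ℚ) → ¬ KummerBlindAtTwo a₂ a₄ e →
      ∀ z : ℚ⟦X⟧, IsParamGerm W D.c a z →
      ∀ (r : ℕ → ℤ) (g A B : ℤ⟦X⟧), IsCuspidalKummerRep N (kummerSeries W D.c ((e : ℚ)) z) r g A B →
      (∀ δ ∈ N.divisors, Even (r δ)) → IsSquare (∏ δ ∈ N.divisors, δ ^ (r δ / 2).natAbs)) :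
    CuspidalKummerOddExponent := by
  intro W _ _ N _ D a ha h4 hLat a₂ a₄ e ha1 ha3 ha2 ha4 he hnb z hz r g A B hrep
  have h2 : 2 ∣ N := (by norm_num : (2 : ℕ) ∣ 4).trans h4
  rcases exists_odd_or_not_isSquare_of_isCuspidalKummerRep W D a ha h2 hLat he z hz hrep with h | hnsq
  · exact h
  · by_contra hcon
    have hev : ∀ δ ∈ N.divisors, Even (r δ) := fun δ hδ =>
      Int.not_odd_iff_even.mp fun hodd => hcon ⟨δ, hδ, hodd⟩
    exact hnsq (hL W D a ha h4 hLat a₂ a₄ e ha1 ha3 ha2 ha4 he hnb z hz r g A B hrep hev)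

end Summit.BirchSwinnertonDyer.BirchSwinnertonDyer.Theorems.ManinLocalTwoThree.SquareRootDescent

end
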